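import Mathlib.Analysis.Calculus.InverseFunctionTheorem.FDeriv
import Mathlib.Analysis.Calculus.ContDiff.Comp
import Mathlib.Analysis.Calculus.ContDiff.RCLike
import Mathlib.Analysis.Normed.Module.Complemented
import Mathlib.Analysis.Normed.Operator.Prod
import Mathlib.MeasureTheory.Function.Jacobian
import Mathlib.MeasureTheory.Measure.Haar.Unique
import Mathlib.Topology.Algebra.Module.FiniteDimension
import HarnessLib

/-!
# Submersions pull Lebesgue-null sets back to Lebesgue-null sets

Analysis/Calculus support file (serves the provefact unit of
`Literature.MathematicalPhysics.KineticTheory.HeatConduction.CuneoEckmannHairerReyBellet2018_pinnedChain`,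
second seat: absolute continuity of the transition probabilities of the Langevin-driven chain by
a finite-dimensional "partial Malliavin" argument, whose measure-theoretic core is the present
file). Everything here is PROVED from Mathlib; no named facts.

**Theorem (the easy half of Sard's theorem / the co-area picture).** Let `E`, `F` be
finite-dimensional real normed spaces with additive Haar (Lebesgue) measures `μ`, `ν`, and let
`f : E → F` be `C¹` on an open set `U` with SURJECTIVE differential `Df(x)` at every `x ∈ U`
(a submersion). Then for every `ν`-null set `s ⊆ F` the set `U ∩ f ⁻¹' s` is `μ`-null
(`Literature.Analysis.Calculus.measure_inter_preimage_null_of_submersion`). Consequently the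
image under `f` of any measure `ρ ≪ μ` carried by `U` is absolutely continuous with respect to
`ν` (`Literature.Analysis.Calculus.map_absolutelyContinuous_of_submersion`): **submersions push
absolutely continuous measures forward to absolutely continuous measures.**

## The proof

Locally at `a ∈ U` (`exists_nhds_measure_inter_preimage_null`): let `K = ker Df(a)` and let
`p : E →L K` be a continuous projection onto `K` (it exists, `K` being closed-complemented as the
kernel of a map with finite-dimensional range, Mathlib's
`ContinuousLinearMap.ker_closedComplemented_of_finiteDimensional_range`); then
`M = (Df(a), p) : E ≃L F × K` is a linear isomorphism
(`ContinuousLinearMap.equivProdOfSurjectiveOfIsCompl`) and the self-map `Ψ = M⁻¹ ∘ (f, p)` of `E`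
has derivative `id` at `a`. By the inverse function theorem
(`HasStrictFDerivAt.toOpenPartialHomeomorph`) `Ψ` is injective near `a`, and by continuity of
`x ↦ det DΨ(x)` we have `|det DΨ| ≥ 1/2` near `a`. On such a neighbourhood `U₀`, for a measurable
`ν`-null `t`, the set `A = U₀ ∩ f ⁻¹' t` satisfies `Ψ(A) ⊆ M⁻¹(t × K)`, a `μ`-null set (linear
images of Haar measures are Haar measures, and `(ν ⊗ Haar_K)(t × K) = 0`), so Mathlib's change of
variables INEQUALITY `∫_A |det DΨ| dμ ≤ μ(Ψ(A))` (`lintegral_abs_det_fderiv_le_addHaar_image`,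
valid for maps injective and differentiable on a measurable set) gives `μ(A)/2 ≤ 0`. The global
statement follows by a countable subcover (second countability).

This is the standard fact that a submersion is "absolutely continuous in measure" (the
qualitative shadow of the co-area formula); we only need, and only prove, the null-set
statement. [folklore]

## Design choices

* Hypotheses are `ContDiffAt ℝ 1 f a` / `ContDiffOn ℝ 1 f U` with `U` open, and surjectivity as
  `LinearMap.range (fderiv ℝ f x) = ⊤` (the form consumed by
  `ContinuousLinearMap.equivProdOfSurjectiveOfIsCompl`).
* No measurability of `f` is assumed: on the open set where `f` is `C¹` it is continuous, and
  `U ∩ f ⁻¹' t` is measurable through the measurable modification `U.piecewise f const`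
  (`ContinuousOn.measurable_piecewise`).
-/

noncomputable section

open MeasureTheory Set Filter Topology

namespace Literature.Analysis.Calculus

variable {E F : Type*} [NormedAddCommGroup E] [NormedSpace ℝ E] [FiniteDimensional ℝ E]
  [MeasurableSpace E] [BorelSpace E] [NormedAddCommGroup F] [NormedSpace ℝ F]
  [FiniteDimensional ℝ F] [MeasurableSpace F] [BorelSpace F]
  (μ : Measure E) [μ.IsAddHaarMeasure] (ν : Measure F) [ν.IsAddHaarMeasure]

/-- **Local null-preimage property of a submersion.** If `f : E → F` is `C¹` at `a` with
surjective differential `Df(a)`, then on some neighbourhood `U` of `a` the preimage of every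
`ν`-null set is `μ`-null: `μ (U ∩ f ⁻¹' s) = 0` whenever `ν s = 0` (`μ`, `ν` additive Haar
measures of the finite-dimensional spaces `E`, `F`). [folklore] -/
theorem exists_nhds_measure_inter_preimage_null (f : E → F) {a : E} (hf : ContDiffAt ℝ 1 f a)
    (hsurj : LinearMap.range (fderiv ℝ f a : E →ₗ[ℝ] F) = ⊤) :
    ∃ U ∈ 𝓝 a, ∀ s : Set F, ν s = 0 → μ (U ∩ f ⁻¹' s) = 0 := by
  set f' : E →L[ℝ] F := fderiv ℝ f a with hf'def
  -- a continuous projection onto the kernel, and the linear isomorphism `M = (f', p)`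
  obtain ⟨p, hp⟩ := f'.ker_closedComplemented_of_finiteDimensional_range
  let K : Submodule ℝ E := LinearMap.ker (f' : E →ₗ[ℝ] F)
  have hp' : ∀ x : K, (p : E →ₗ[ℝ] K) x = x := fun x => hp x
  have hp_range : LinearMap.range (p : E →ₗ[ℝ] K) = ⊤ := LinearMap.range_eq_of_proj hp'
  have hcompl : IsCompl K (LinearMap.ker (p : E →ₗ[ℝ] K)) := LinearMap.isCompl_of_proj hp'
  set M : E ≃L[ℝ] F × K := f'.equivProdOfSurjectiveOfIsCompl p hsurj hp_range hcompl with hMdef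
  have hM : ∀ x, M x = (f' x, p x) := fun x => rfl
  -- the auxiliary self-map `Ψ = M⁻¹ ∘ (f, p)`; its derivative where `f` is differentiable
  set Ψ : E → E := fun x => M.symm (f x, p x) with hΨdef
  set D : E → E →L[ℝ] E := fun x => (M.symm : F × K →L[ℝ] E).comp ((fderiv ℝ f x).prod p)
    with hDdef
  have hΨderiv : ∀ x, DifferentiableAt ℝ f x → HasFDerivAt Ψ (D x) x := fun x hx =>
    M.symm.hasFDerivAt.comp x (hx.hasFDerivAt.prodMk p.hasFDerivAt)
  have hDa : D a = ContinuousLinearMap.id ℝ E := by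
    ext x
    change M.symm (f' x, p x) = x
    rw [← hM x, ContinuousLinearEquiv.symm_apply_apply]
  have hΨstrict : HasStrictFDerivAt Ψ ((ContinuousLinearEquiv.refl ℝ E : E →L[ℝ] E)) a := by
    have h1 : HasStrictFDerivAt (fun x => (f x, p x)) (f'.prod p) a :=
      (hf.hasStrictFDerivAt one_ne_zero).prodMk p.hasStrictFDerivAt
    have h2 := M.symm.hasStrictFDerivAt.comp a h1
    have h3 : (M.symm : F × K →L[ℝ] E).comp (f'.prod p) =
        ((ContinuousLinearEquiv.refl ℝ E : E →L[ℝ] E)) := by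
      ext x
      change M.symm (f' x, p x) = x
      rw [← hM x, ContinuousLinearEquiv.symm_apply_apply]
    rw [← h3]
    exact h2
  -- local injectivity of `Ψ` (inverse function theorem)
  set Φ := hΨstrict.toOpenPartialHomeomorph Ψ with hΦdef
  have ha_src : a ∈ Φ.source := hΨstrict.mem_toOpenPartialHomeomorph_source
  have hΦinj : InjOn Ψ Φ.source := Φ.injOn
  -- `|det DΨ| ≥ 1/2` near `a`
  have hDcont : ContinuousAt D a := by
    have h1 : ContinuousAt (fun x => fderiv ℝ f x) a := hf.continuousAt_fderiv (by simp)
    have h2 : Continuous fun A : E →L[ℝ] F => (M.symm : F × K →L[ℝ] E).comp (A.prod p) := by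
      have h3 : Continuous fun A : E →L[ℝ] F => A.prod p :=
        (ContinuousLinearMap.prodₗᵢ ℝ).continuous.comp (continuous_id.prodMk continuous_const)
      exact continuous_const.clm_comp h3
    exact h2.continuousAt.comp h1
  have hdet : ∀ᶠ x in 𝓝 a, (1 / 2 : ℝ) ≤ |(D x).det| := by
    have hc : ContinuousAt (fun x => |(D x).det|) a :=
      (continuous_abs.comp ContinuousLinearMap.continuous_det).continuousAt.comp hDcont
    have h1 : |(D a).det| = 1 := by
      rw [hDa]
      simp [ContinuousLinearMap.det]
    have h2 : ∀ᶠ x in 𝓝 a, (1 / 2 : ℝ) < |(D x).det| :=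
      hc.eventually_mem (lt_mem_nhds (by rw [h1]; norm_num))
    exact h2.mono fun x hx => hx.le
  have hC1 : ∀ᶠ x in 𝓝 a, ContDiffAt ℝ 1 f x := hf.eventually (by simp)
  -- the neighbourhood
  obtain ⟨U, hUsub, hUopen, haU⟩ : ∃ U ⊆ (Φ.source ∩ {x | (1 / 2 : ℝ) ≤ |(D x).det|}) ∩
      {x | ContDiffAt ℝ 1 f x}, IsOpen U ∧ a ∈ U :=
    mem_nhds_iff.1 (inter_mem (inter_mem (Φ.open_source.mem_nhds ha_src) hdet) hC1)
  refine ⟨U, hUopen.mem_nhds haU, fun s hs => ?_⟩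
  -- reduce to a measurable null set `t ⊇ s`
  obtain ⟨t, hst, htm, ht⟩ := exists_measurable_superset_of_null hs
  refine measure_mono_null (inter_subset_inter_right _ (preimage_mono hst)) ?_
  -- `A = U ∩ f ⁻¹' t` is measurable (`f` is continuous on the open set `U`)
  have hfU : ContinuousOn f U := fun x hx =>
    (show ContDiffAt ℝ 1 f x from (hUsub hx).2).continuousAt.continuousWithinAt
  classical
  have hgm : Measurable (U.piecewise f fun _ => f a) :=
    hfU.measurable_piecewise continuousOn_const hUopen.measurableSet
  have hA_eq : U ∩ f ⁻¹' t = U ∩ (U.piecewise f fun _ => f a) ⁻¹' t := by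
    ext x
    simp only [mem_inter_iff, mem_preimage]
    constructor
    · rintro ⟨hx, hfx⟩
      exact ⟨hx, by rwa [piecewise_eq_of_mem _ _ _ hx]⟩
    · rintro ⟨hx, hgx⟩
      exact ⟨hx, by rwa [piecewise_eq_of_mem _ _ _ hx] at hgx⟩
  have hAm : MeasurableSet (U ∩ f ⁻¹' t) := by
    rw [hA_eq]
    exact hUopen.measurableSet.inter (hgm htm)
  set A := U ∩ f ⁻¹' t with hAdef
  -- change of variables inequality for the injective differentiable map `Ψ` on `A`
  have hderivA : ∀ x ∈ A, HasFDerivWithinAt Ψ (D x) A x := fun x hx =>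
    (hΨderiv x ((show ContDiffAt ℝ 1 f x from (hUsub hx.1).2).differentiableAt
      one_ne_zero)).hasFDerivWithinAt
  have hinjA : InjOn Ψ A := hΦinj.mono fun x hx => (hUsub hx.1).1.1
  have hJ := lintegral_abs_det_fderiv_le_addHaar_image μ hAm hderivA hinjA
  -- the image lies in the null set `M ⁻¹' (t × K)`
  have himage : Ψ '' A ⊆ M ⁻¹' (t ×ˢ (univ : Set K)) := by
    rintro _ ⟨x, hx, rfl⟩
    simp only [mem_preimage, hΨdef, ContinuousLinearEquiv.apply_symm_apply, mem_prod, mem_univ,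
      and_true]
    exact hx.2
  have hnull : μ (M ⁻¹' (t ×ˢ (univ : Set K))) = 0 := by
    have hmeas : MeasurableSet (t ×ˢ (univ : Set K)) := htm.prod MeasurableSet.univ
    rw [← Measure.map_apply M.continuous.measurable hmeas]
    have hac : μ.map M ≪ ν.prod (Measure.addHaar : Measure K) :=
      Measure.absolutelyContinuous_isAddHaarMeasure _ _
    refine hac ?_
    rw [Measure.prod_prod, ht, zero_mul]
  have hzero : ∫⁻ x in A, ENNReal.ofReal |(D x).det| ∂μ = 0 :=
    le_antisymm (hJ.trans ((measure_mono himage).trans hnull.le)) zero_le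
  -- while the integrand is at least `1/2` on `A`
  have hlow : ENNReal.ofReal (1 / 2) * μ A ≤ ∫⁻ x in A, ENNReal.ofReal |(D x).det| ∂μ := by
    rw [← setLIntegral_const]
    exact setLIntegral_mono' hAm fun x hx => ENNReal.ofReal_le_ofReal (hUsub hx.1).1.2
  rw [hzero, nonpos_iff_eq_zero, mul_eq_zero] at hlow
  exact hlow.resolve_left (by simp)

/-- **Submersions pull null sets back to null sets.** If `f : E → F` is `C¹` on the open set
`U` and `Df(x)` is surjective for every `x ∈ U`, then `μ (U ∩ f ⁻¹' s) = 0` for every `ν`-null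
set `s` (`μ`, `ν` additive Haar measures of the finite-dimensional spaces `E`, `F`). [folklore] -/
theorem measure_inter_preimage_null_of_submersion {f : E → F} {U : Set E} (hU : IsOpen U)
    (hf : ContDiffOn ℝ 1 f U) (hsurj : ∀ x ∈ U, LinearMap.range (fderiv ℝ f x : E →ₗ[ℝ] F) = ⊤)
    {s : Set F} (hs : ν s = 0) : μ (U ∩ f ⁻¹' s) = 0 := by
  have hloc : ∀ x ∈ U, ∃ V ∈ 𝓝[U] x, μ (V ∩ f ⁻¹' s) = 0 := by
    intro x hx
    obtain ⟨V, hV, hVnull⟩ := exists_nhds_measure_inter_preimage_null μ ν f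
      (hf.contDiffAt (hU.mem_nhds hx)) (hsurj x hx)
    exact ⟨V, mem_nhdsWithin_of_mem_nhds hV, hVnull s hs⟩
  choose! V hV hVnull using hloc
  obtain ⟨T, hTU, hTc, hUT⟩ := TopologicalSpace.countable_cover_nhdsWithin hV
  refine measure_mono_null (t := ⋃ x ∈ T, V x ∩ f ⁻¹' s) ?_ ((measure_biUnion_null_iff hTc).2
    fun x hx => hVnull x (hTU hx))
  rintro y ⟨hyU, hys⟩
  obtain ⟨x, hxT, hyV⟩ := mem_iUnion₂.1 (hUT hyU)
  exact mem_iUnion₂.2 ⟨x, hxT, hyV, hys⟩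

/-- The same for any measure `ρ ≪ μ` (e.g. a Gaussian measure): `ρ (U ∩ f ⁻¹' s) = 0` for
`ν`-null `s`, `f` a `C¹` submersion on the open set `U`. [folklore] -/
theorem measure_inter_preimage_null_of_submersion' {f : E → F} {U : Set E} (hU : IsOpen U)
    (hf : ContDiffOn ℝ 1 f U) (hsurj : ∀ x ∈ U, LinearMap.range (fderiv ℝ f x : E →ₗ[ℝ] F) = ⊤)
    (ρ : Measure E) (hρ : ρ ≪ μ) {s : Set F} (hs : ν s = 0) : ρ (U ∩ f ⁻¹' s) = 0 :=
  hρ (measure_inter_preimage_null_of_submersion μ ν hU hf hsurj hs)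

/-- **Submersions push absolutely continuous measures to absolutely continuous measures**: if
`ρ ≪ μ` and `f` is a `C¹` submersion on the open set `U` (a.e.-measurable for `ρ|_U`), then the
image of `ρ|_U` under `f` is absolutely continuous with respect to `ν`. [folklore] -/
theorem map_restrict_absolutelyContinuous_of_submersion {f : E → F} {U : Set E} (hU : IsOpen U)
    (hf : ContDiffOn ℝ 1 f U) (hsurj : ∀ x ∈ U, LinearMap.range (fderiv ℝ f x : E →ₗ[ℝ] F) = ⊤)
    (ρ : Measure E) (hρ : ρ ≪ μ) (hfm : AEMeasurable f (ρ.restrict U)) :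
    (ρ.restrict U).map f ≪ ν := by
  refine Measure.AbsolutelyContinuous.mk fun s hsm hs => ?_
  rw [Measure.map_apply_of_aemeasurable hfm hsm, Measure.restrict_apply' hU.measurableSet,
    inter_comm]
  exact measure_inter_preimage_null_of_submersion' μ ν hU hf hsurj ρ hρ hs

end Literature.Analysis.Calculus
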